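import Mathlib
import Literature.Computability.Complexity.RangeAvoidance
import Literature.Computability.Complexity.SignDegreeXor
import Summits.PneNP.PneNP.Theorems.PstarIsolation
import Summits.PneNP.PneNP.Theorems.PstarTyped
import Summits.PneNP.PneNP.Theorems.PstarTypedDouble

/-!
# Bridge between the two typed-`P⋆` APIs (cell `pnp-ideate`, ROUND-20 §2; referee SCORE 58 recommendation)

FRONTIER range-avoidance ladder, rung F-N3 — bookkeeping only; nothing here bears on `P` vs `NP`.

ROUND-20's typed reduction landed twice within minutes: `PstarTyped` (planner p3: `Finset`-indexed cut /
clique vectors; owns the hub mechanism `onesFlip_mem_range_of_typed_bipartite`) and `PstarTypedDouble` (prover-1: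
function-indexed vectors; owns the class `PstarTypedAvoidLinearFP` and the FP layer `PstarTypedDoubleFP`).  This file
is the one bridge the referee asked for, so that either API can be cited from the other without restating:
the two `Typed` predicates coincide (`typed_iff`), the two instance classes are EQUAL as class predicates
(`typedPstar_eq_typedPure`, hence `localAvoidLinearFP_typedPstar_iff`), the two doubles are the same `LocalMap`
(`typedDouble_eq`), and the cut / clique vectors agree along `Finset ↔ indicator` (`cutVec_eq`, `cliqueVec_eq`,
`cutVec_eq'`, `cliqueVec_eq'`).  [posed and proved in the cell]
-/

set_option linter.dupNamespace false

open Literature.Computability.Complexity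

namespace Summit.PneNP.PneNP.Theorems.PstarTypedBridge

variable {n m : ℕ}

/-- The two `Typed` predicates coincide (`¬ IsXorSlot t ↔ 2 ≤ t`). -/
theorem typed_iff (I : LocalMap 4 n m) : PstarTyped.Typed I ↔ PstarTypedDouble.Typed I := by
  simp only [PstarTyped.Typed, PstarTypedDouble.Typed, PstarTypedDouble.IsXorSlot, not_lt]

/-- The two instance classes "pure `P⋆` and typed" are equal as class predicates. -/
theorem typedPstar_eq_typedPure : PstarTyped.TypedPstar = PstarTypedDouble.TypedPure := by
  funext n m I
  exact propext (and_congr Iff.rfl (typed_iff I))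

/-- Hence the two typed-avoidance statements are the same statement. -/
theorem localAvoidLinearFP_typedPstar_iff :
    LocalAvoidLinearFP 4 PstarTyped.TypedPstar ↔ PstarTypedDouble.PstarTypedAvoidLinearFP := by
  rw [typedPstar_eq_typedPure]
  rfl

/-- The two typed doubles are the same `4`-local map. -/
theorem typedDouble_eq (I : LocalMap 4 n m) : PstarTyped.typedDouble I = PstarTypedDouble.typedDouble I := rfl

/-- `Finset`-indexed cut vector = function-indexed cut vector of the indicator. -/
theorem cutVec_eq (I : LocalMap 4 n m) (T : Finset (Fin n)) :
    PstarTyped.cutVec I T = PstarTypedDouble.cutVec I (fun v => decide (v ∈ T)) := rfl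

/-- `Finset`-indexed clique vector = function-indexed clique vector of the indicator. -/
theorem cliqueVec_eq (I : LocalMap 4 n m) (S : Finset (Fin n)) :
    PstarTyped.cliqueVec I S = PstarTypedDouble.cliqueVec I (fun v => decide (v ∈ S)) := rfl

/-- Function-indexed cut vector = `Finset`-indexed cut vector of the support. -/
theorem cutVec_eq' (I : LocalMap 4 n m) (t : Fin n → Bool) :
    PstarTypedDouble.cutVec I t = PstarTyped.cutVec I (Finset.univ.filter fun v => t v = true) := by
  funext j
  simp [PstarTyped.cutVec, PstarTypedDouble.cutVec]

/-- Function-indexed clique vector = `Finset`-indexed clique vector of the support. -/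
theorem cliqueVec_eq' (I : LocalMap 4 n m) (z : Fin n → Bool) :
    PstarTypedDouble.cliqueVec I z = PstarTyped.cliqueVec I (Finset.univ.filter fun v => z v = true) := by
  funext j
  simp [PstarTyped.cliqueVec, PstarTypedDouble.cliqueVec]

end Summit.PneNP.PneNP.Theorems.PstarTypedBridge
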